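import Summits.CriticalPhenomena.PercolationContinuityZ3.Cruxes.FreeBoxSparse.SketchIdeator1

/-! Triage r1-1 scratch: the repaired Transfer of card `lss-bgn-gluing-ceiling` (threshold form). -/

noncomputable section
open MeasureTheory Filter Topology
open Literature.Probability.Percolation Literature.Probability.LatticeModels
open Summit.CriticalPhenomena.PercolationContinuityZ3.Cruxes.FreeBoxSparse.Sketch

namespace Summit.CriticalPhenomena.PercolationContinuityZ3.Cruxes.FreeBoxSparse.TriageR1K1

/-- The ceiling at a NAMED constant `ε₀` (card 2's `GluingCeiling` is `∃ ε₀ > 0, GluingCeilingAt ε₀`). -/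
def GluingCeilingAt (ε₀ : ℝ) : Prop :=
  ∀ δ : ℝ, 0 < δ → ∀ n : ℕ, 1 ≤ n →
    (bondPercolation (zdGraph 3) (criticalProbI 3)).real
      {ω | (∃ x ∈ box 3 n, IsDense δ (box 3 n) ω x) ∧
           (∃ y ∈ boxAt (shiftVec n) n, IsDense δ (boxAt (shiftVec n) n) ω y) ∧
           ∀ x ∈ box 3 n, ∀ y ∈ boxAt (shiftVec n) n,
             IsDense δ (box 3 n) ω x → IsDense δ (boxAt (shiftVec n) n) ω y →
               ω ∈ openConnIn ((↑(box 3 n) : Set V3) ∪ ↑(boxAt (shiftVec n) n)) x y}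
      ≤ 1 - ε₀

/-- REPAIRED Transfer C⁺' (threshold form): for every density `δ`, eventually the probability that
the two adjacent boxes carry `δ`-dense free clusters NOT joined inside the union is `< ε₀ / 2`.
(`C⁺' ε₀ ∧ GluingCeilingAt ε₀ ⇒ FreeBoxSparse` by boosting/tightness: `¬FBS` gives scales with
`P(δ'-dense) ≥ 1 - ε₀/4` in each box, the ceiling then forces the event below with probability
`≥ ε₀/2` infinitely often.) -/
def AdjacentUngluedRare (ε₀ : ℝ) : Prop :=
  ∀ δ : ℝ, 0 < δ → ∀ᶠ n : ℕ in atTop,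
    (bondPercolation (zdGraph 3) (criticalProbI 3)).real
      {ω | ∃ x ∈ box 3 n, ∃ y ∈ boxAt (shiftVec n) n,
           IsDense δ (box 3 n) ω x ∧ IsDense δ (boxAt (shiftVec n) n) ω y ∧
           ω ∉ openConnIn ((↑(box 3 n) : Set V3) ∪ ↑(boxAt (shiftVec n) n)) x y}
      < ε₀ / 2

/-- The repaired line of card 2 (and, with the corridor clause of card 1 added to the event, of
card 1): one constant `ε₀`, ceiling + rarity ⇒ crux. -/
def RepairedLine : Prop :=
  ∀ ε₀ : ℝ, 0 < ε₀ → GluingCeilingAt ε₀ → AdjacentUngluedRare ε₀ →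
    Summit.CriticalPhenomena.PercolationContinuityZ3.Theses.PercNonProliferation.FreeBoxSparse

/-- The card's Transfer AS TYPED, made explicit: given the ceiling at `ε₀` its conclusion
`∃ n, P(GoodPair) > 1 - ε₀` is unsatisfiable, so it is equivalent to the failure of its hypothesis,
i.e. to `∀ δ, ∃ ε > 0, ∀ᶠ n, P(∃ δ-dense) < 1 - ε` — which does NOT exclude the linear profile
`P(|K_max^free(Λ_n)| ≥ δ|Λ_n|) → 1 - c δ` (`0 < δ ≤ θ*`; compatible with BK sub-multiplicativity
`P(≥ (2N+1)t) ≤ P(≥ t)^{N+1}` by Bernoulli's inequality and with `P(|K_max| < εM) ≤ 8ε`; violates FBS). -/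
def TransferAsTyped (ε₀ : ℝ) : Prop :=
  ∀ δ : ℝ, 0 < δ →
    (∀ ε : ℝ, 0 < ε → ∃ᶠ n : ℕ in atTop,
      1 - ε ≤ (bondPercolation (zdGraph 3) (criticalProbI 3)).real
        {ω | ∃ x ∈ box 3 n, IsDense δ (box 3 n) ω x}) →
    ∃ n : ℕ, 1 ≤ n ∧ 1 - ε₀ <
      (bondPercolation (zdGraph 3) (criticalProbI 3)).real
        {ω | (∃ x ∈ box 3 n, IsDense δ (box 3 n) ω x) ∧
             (∃ y ∈ boxAt (shiftVec n) n, IsDense δ (boxAt (shiftVec n) n) ω y) ∧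
             ∀ x ∈ box 3 n, ∀ y ∈ boxAt (shiftVec n) n,
               IsDense δ (box 3 n) ω x → IsDense δ (boxAt (shiftVec n) n) ω y →
                 ω ∈ openConnIn ((↑(box 3 n) : Set V3) ∪ ↑(boxAt (shiftVec n) n)) x y}

/-- Sanity: under the ceiling the typed Transfer collapses to the negation of its hypothesis. -/
theorem transferAsTyped_iff (ε₀ : ℝ) (hC : GluingCeilingAt ε₀) :
    TransferAsTyped ε₀ ↔ ∀ δ : ℝ, 0 < δ →
      ¬ (∀ ε : ℝ, 0 < ε → ∃ᶠ n : ℕ in atTop,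
        1 - ε ≤ (bondPercolation (zdGraph 3) (criticalProbI 3)).real
          {ω | ∃ x ∈ box 3 n, IsDense δ (box 3 n) ω x}) := by
  unfold TransferAsTyped
  refine forall₂_congr fun δ hδ => ⟨fun h hyp => ?_, fun h hyp => (h hyp).elim⟩
  obtain ⟨n, hn, hlt⟩ := h hyp
  have := hC δ hδ n hn
  linarith

end Summit.CriticalPhenomena.PercolationContinuityZ3.Cruxes.FreeBoxSparse.TriageR1K1
end
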